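import Mathlib
import HarnessLib
import HarnessLib.Audit
import Summits.AtomisticToContinuum.Statement
import Literature.MathematicalPhysics.KineticTheory.LangevinChainKernel
import Literature.MathematicalPhysics.KineticTheory.LangevinChainGibbs
import Summits.AtomisticToContinuum.FouriersLaw.Theorems.EmbeddedDrudeMourreNessUnique
import HarnessLib.Audit.Status.Attr

/-!
Route: ContactEchoEpochs

DORMANT since 2026-08-22T06:39:34Z (reconciler: no traction for 5.1 d (last activity item-evidence-added at 2026-08-17T02:45:08Z); parked, not closed — `ledger route dormant route-AtomisticToContinuum-ContactEchoEpochs --off` to reactiv) — unstaffed, not closed; items shared with open routes are served there. `ledger route dormant <id> --off` reactivates.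

# Route ContactEchoEpochs — conductance is the time-integrated contact-to-contact power echo;
Fourier's law from dark time + equilibrium fluctuation window + polynomial gap tail

X_E (CONTACT-ECHO LINE; realises card contact-cross-correlation-three-windows; the conforming
re-filing of route ContactEchoWindows,
retired 2026-08-15 `not-a-thesis` because its Assembly ended in the Literature constant — statements
unchanged, the deciding theorem added).
Notation, all in the tree: P = pinnedChain ω₂ lam β γ (ω₂, lam, β, γ > 0), N = n + 2 ≥ 2 sites, μ_T
= P.gibbsMeasure N T (both baths at T > 0),
P_t = P.transitionKernel N T T t (the CONSTRUCTED kernels of the Langevin SDE), contact powers w_L =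
γ(T − p_0²), w_R = γ(T − p_(N−1)²), and the
contact echo c_N(t) := ∫ w_L · (P_t w_R) dμ_T. It suffices to show, for all parameters and every T >
0:
(K) ContactKubo: under weak-NESS uniqueness, c_N ∈ L¹(0,∞) and for EVERY steady-state family D_N =
lim_δ totalCurrent/δ = (N−1) T⁻² ∫₀^∞ c_N
(conductance = time-integrated contact-to-contact power echo, no O(1) subtraction); (W1) DarkTime: ∃
v > 0, (N−1) T⁻² ∫₀^(N/v) |c_N| → 0;
(W2) EquilibriumFluctuationWindow: ∃ κ > 0, ∀ v > 0, ∀ a > 2, (N−1) T⁻² ∫_(N/v)^(N^a) c_N → κ (κ(T)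
is DEFINED here); (W3) PolynomialGapTail:
∃ a > 2, (N−1) T⁻² ∫_(N^a)^∞ |c_N| → 0; and NessUnique (uniqueness of the weak steady state, shared
item). Then the target EchoLimit
((N−1) T⁻² ∫₀^∞ c_N → κ(T) > 0, i.e. D_N → κ(T) ∈ (0,∞)) follows by splitting one time integral
(support EchoLimitOfWindows), and clause (i) of
FouriersLawFor is PinnedSteadyStateExists (shared support item, provable now: the PROVED Literature
theorem pinnedChain_exists_isSteadyState) + NessUnique. X_E = K ∧ W1 ∧ W2 ∧ W3 ∧ NessUnique.
DECIDES THE SUB-PROBLEM (D-0027 §2.1): `theorem closes (hNU : NessUnique) (hEx :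
PinnedSteadyStateExists) (hCK : ContactKubo) (hW1 : DarkTime)
(hW2 : EquilibriumFluctuationWindow) (hW3 : PolynomialGapTail) (hG : EchoLimitOfWindows) :
_root_.FouriersLaw` is PROVED in this file (gate-certified,
authority native, axioms propext, Classical.choice, Quot.sound): hypotheses are route items only,
conclusion is the Statement decl `FouriersLaw` by name.
Route-repair 2026-08-15 (cone bookkeeping, rev 1–2): clause-(i) existence enters as the item
PinnedSteadyStateExists so that this file imports only
LangevinChainKernel + LangevinChainGibbs (the cone its statements need: 47 constants, 0 unproved);
the LangevinChainNESSHolds import was dropped.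
Lean: `ContactKubo ∧ DarkTime ∧ EquilibriumFluctuationWindow ∧ PolynomialGapTail ∧ NessUnique`

## Assembly
Pure logic once EchoLimitOfWindows is in hand (PROVED in this file as `theorem closes`, ~40 lines,
standard axioms; Assembly is literally its type): fix parameters;
clause (i): existence from item PinnedSteadyStateExists (all N; = the PROVED Literature theorem
pinnedChain_exists_isSteadyState), uniqueness from NessUnique;
clause (ii): EchoLimit := EchoLimitOfWindows ContactKubo NessUnique DarkTime
EquilibriumFluctuationWindow PolynomialGapTail; κ T := the κ of
EchoLimit at T for T > 0 (Classical.choose; 1 otherwise), positive by EchoLimit; given a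
steady-state family μ and T > 0 put D 0 = D 1 := 0
(totalCurrent vanishes identically for N ≤ 1: no bonds — totalCurrent_zero and a two-line simp) and
D (n+2) := (n+1) T⁻² ∫₀^∞ c_(n+2); the per-N
response limits are ContactKubo (N ≥ 2, for every family) and tendsto_const_nhds (N ≤ 1); D → κ T by
EchoLimit and Filter.tendsto_add_atTop_iff_nat 2.

Rationale: WHY THIS LINE. BLR's limit (BonettoLebowitzReyBellet2000 eq. (33)) takes δT → 0 FIRST at fixed N, so
after the finite-N hypoelliptic linear response everything is
EQUILIBRIUM dynamics of the OPEN chain; writing the response in the contact-to-contact form G_N T² =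
∫₀^∞ ⟨w_L, P_t w_R⟩_(μ_T) dt — the cross form of the
open-system Green–Kubo formula (JaksicOgataPillet2006 eq. (1.1)/§2.4 quantum;
MaesNetocnyVerschuere2003, KunduDharNarayan2009 and arXiv:1009.0366
classical, mixed/auto forms), cleaned by the white-noise sum rule ⟨w_L, (−L)⁻¹(w_L + w_R)⟩ = γT²
that follows from L H = w_L + w_R
(generator_hamiltonian_two_baths, PROVED) — makes the Kubo integrand itself O(1/N) with no O(1)
subtraction, and splits the proof of D_N → κ along
the three physical epochs of the echo, each owned by a different existing technology: classical
Lieb–Robinson / finite-speed bounds at positive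
temperature (MarchioroPellegrinottiPulvirenti1978, ButtaEtAl2007, NachtergaeleEtAl2008, RazSims2009)
for W1; equilibrium energy-fluctuation limits
with thermal boundaries (Bernardin2014 §3, KomorowskiOlla2020, KomorowskiOlla2021,
KomorowskiOllaSimon2021 — noisy or harmonic so far; arXiv:2310.13338
for a deterministic bulk with chaotic cells) for W2; the quantitative N-dependent ergodicity
programme (Menegaki2020, BeckerMenegaki2022,
CuneoEckmannHairerReyBellet2018) for W3, of which only a POLYNOMIAL rate N^(−b) is asked, so the
catalogued gap-closing barrier is embraced, not fought.
Imported areas: quasi-locality estimates (quantum-lattice-style LR bounds in classical covariance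
form), hydrodynamic fluctuation theory,
hypocoercive / Harris quantitative ergodicity; no physical analogy beyond the Kubo dictionary itself
(item ContactKubo). What it does that route
FourierGreenKubo does not: no infinite-volume dynamics, no L¹(0,∞) integrability of the BULK current
autocorrelation, no κ = κ_GK identification —
κ(T) is defined on the open chain in the diffusive window and finiteness comes from the W1/W3
cut-offs; what it does that the retired
ContactEchoWindows did not: it literally decides the Statement (`closes` proved). Negatives index:
no FouriersLaw statement refuted at filing.

RANKED CRUXES. #0 EchoLimit (target) — CONTACT-ECHO FORM OF FOURIER'S LAW: for all ω₂, lam, β, γ > 0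
and T > 0 there is κ > 0 with (N−1) T⁻² ∫₀^∞ c_N(t) dt → κ as N → ∞ (N = n+2; c_N as in the Thesis,
inlined over transitionKernel/gibbsMeasure; the set integral is Lean-junk 0 unless c_N ∈ L¹(0,∞),
which ContactKubo supplies). With ContactKubo this is exactly 'D_N → κ(T) ∈ (0,∞)' for every
steady-state family; it is the common consequence of W1–W3 (support EchoLimitOfWindows). (why it
might fail: inherits W2 (deterministic-chain equilibrium fluctuation limit, MacroErgodicity class)
and W3 (no N-polynomial relaxation bound beyond near-harmonic chains); κ might exist only along
subsequences if hyperbolic/polynomial windows carry Θ(1/N) mass.) [BonettoLebowitzReyBellet2000,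
KunduDharNarayan2009, JaksicOgataPillet2006, Bernardin2014, BeckerMenegaki2022]
#2 EquilibriumFluctuationWindow (crux) — (W2, card crux 1) for all parameters > 0 and T > 0 there is
κ > 0 such that for EVERY v > 0 and EVERY a > 2: (N−1) T⁻² ∫_(N/v)^(N^a) c_N(t) dt → κ. Informally:
on diffusive scales N³ c_N(N² s) → T² K_T(s), K_T = contact-to-contact flux kernel of ∂_s e = κ ∂_x²
e on [0,1] with thermalising (Robin/Kapitza) boundary conditions, ∫₀^∞ K_T = κ, with enough uniform
integrability that hyperbolic times t ∈ [N/v, εN²] and polynomial times t ∈ [AN², N^a] carry o(1/N);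
an EQUILIBRIUM energy-fluctuation limit for two boundary observables of the OPEN chain
(Ornstein–Uhlenbeck fluctuation field + Boltzmann–Gibbs principle for w_L, w_R) — the corner where
κ(T) is defined. [difficulty: open-problem] (why it might fail: Boltzmann–Gibbs /
fluctuation–dissipation for a DETERMINISTIC anharmonic bulk is open even at equilibrium
(MacroErgodicity class); the contact (Kapitza) boundary condition is identified only for
harmonic/noisy chains; '∀ a' also asserts no Θ(1/N) mass at polynomial times ≫ N².) [Bernardin2014,
KomorowskiOlla2021, KomorowskiOllaSimon2021, KomorowskiOlla2020, BonettoLebowitzReyBellet2000,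
arXiv:2310.13338]
#3 PolynomialGapTail (crux) — (W3, card crux 2, integrated form) for all parameters > 0 and T > 0
there is a > 2 such that t ↦ c_N(t) is integrable on (N^a, ∞) for every N and (N−1) T⁻² ∫_(N^a)^∞
|c_N(t)| dt → 0. Sufficient: an L²(μ_T) relaxation bound for the contact observable with POLYNOMIAL
N-tracking, ‖P_t w_R‖₂ ≤ C N^m e^(−c t N^(−b)) (then any a > b works; the harmonic corner has
exactly b = 3, so expect a > b ≥ 3); stretched-exponential or t^(−k) N^m decay also suffices.
Consistent with λ_S ≤ γ/N (BeckerMenegaki2022_gapClosing) and with the equilibrium transport bound λ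
≤ 4√2 γ ln(2C)/√N (equilibrium_rate_bound, PROVED): rates are used only at times t ≥ N^a ≫ N².
[difficulty: XL] (why it might fail: N-dependent lower bounds on relaxation exist only near-harmonic
(Menegaki2020: N⁻³-type under N-small anharmonicity); metastable high-energy (breather-like) states
could make contact relaxation slower than any power of N (cf. essential spectrum at 0 when pinning
dominates, HairerMattingly2009).) [BeckerMenegaki2022, Menegaki2020,
CuneoEckmannHairerReyBellet2018, HairerMattingly2009, Znidaric2015]
#4 DarkTime (crux) — (W1, card crux 3, integrated form) for all parameters > 0 and T > 0 there is v
> 0 with (N−1) T⁻² ∫₀^(N/v) |c_N(t)| dt → 0. Sufficient: a covariance-form classical Lieb–Robinson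
bound for the thermal pinned chain, |Cov_(μ_T)(w_L, P_t w_R)| ≤ C (1+t)^m e^(−c(N − v₀t)) for t ≤
N/v₀ (take v = 2v₀); note c_N(0) = 0 exactly (p_0 ⊥ p_(N−1) under μ_T) and equal-time spatial
correlations of μ_T decay exponentially (1-D transfer operator). [difficulty: L] (why it might fail:
sup-norm Lieb–Robinson is false for unbounded (quartic) forces; the printed Gibbs-averaged bounds
(ButtaEtAl2007, RazSims2009) have cones r ∼ t log^α t and moment prefactors, so a fixed v may need
'no mass just after arrival' too; Langevin contacts must not spoil quasi-locality.)
[NachtergaeleEtAl2008, RazSims2009, ButtaEtAl2007, MarchioroPellegrinottiPulvirenti1978,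
doi:10.4064/cm118-2-17]
#5 ContactKubo (crux) — (K, card support (a)(b), fixed N, theorem-grade but unprinted) CONTACT FORM
OF THE FINITE-VOLUME KUBO FORMULA: for all parameters > 0, IF weak steady states (IsSteadyState) are
unique for all N, T_L, T_R > 0 (= NessUnique), then for every T > 0 and N = n+2: t ↦ c_N(t) is
integrable on (0,∞), and for every family μ of weak steady states lim_(δ→0,δ≠0) totalCurrent(μ N
(T+δ/2) (T−δ/2))/δ = (N−1) T⁻² ∫₀^∞ c_N(t) dt. Content: (a) Hairer–Majda linear response for the
hypoelliptic Langevin chain (CEHR Lyapunov/spectral-gap structure), response of J̃ = μ_δ(w_L^(T_L))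
to ∂_δ L = (γ/2)(∂²_(p_0) − ∂²_(p_(N−1))): G_N = γ/2 + (2T²)⁻¹ ∫₀^∞ ⟨w_R − w_L, P_t w_L⟩ dt; (b)
Π-reversibility (P_t* = Π P_t Π in L²(μ_T), w's even) gives ⟨w_R, P_t w_L⟩ = ⟨w_L, P_t w_R⟩; (c) the
single-bath sum rule ∫₀^∞ ⟨w_L, P_t(w_L + w_R)⟩ dt = γ Cov(p_0², H) = γT² (L H = w_L + w_R:
generator_hamiltonian_two_baths, PROVED) kills the auto term: G_N = T⁻² ∫₀^∞ c_N; all bond currents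
have mean J̃, totalCurrent = (N−1) J̃; N ≤ 1 has no bonds (handled in `closes`). Checked numerically
by the gen-1 planner (harmonic N = 2,3,4, Lyapunov equation vs matrix-exponential quadrature: J̃/δ =
T⁻²∫c_N to 6 digits, 0.1667, 0.1364, 0.1279 at ω₂ = γ = T = 1) and re-derived by the refuter audit.
Shares its hypothesis and infrastructure with FourierGreenKubo's FiniteResponse
(stmt-AtomisticToContinuum-0717) / FiniteResponseOfUnique and OscillatorChain.KuboFormula
(LangevinSemigroup.lean). [deps: NessUnique] [difficulty: XL] (why it might fail: BLR p.16: the Kubo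
formula (32) is unproved for Langevin reservoirs; Hairer–Majda needs the perturbation (γ/2)(∂²_(p_0)
− ∂²_(p_(N−1))) tamed by ONE weighted space with spectral gap for all small δ, and c_N ∈ L¹ needs
mixing for quadratic observables, printed only in e^(θH)-weighted sup norms.) [HairerMajda2009,
ReyBellet2003, KunduDharNarayan2009, JaksicOgataPillet2006, MaesNetocnyVerschuere2003,
CuneoEckmannHairerReyBellet2018, BonettoLebowitzReyBellet2000]
#9 NessUnique (support) — [shared verbatim with route FourierGreenKubo / OddSectorIrreversibility
item stmt-AtomisticToContinuum-0741] uniqueness of the weak steady state (IsSteadyState class) of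
pinnedChain for all N, T_L, T_R > 0; the hypothesis of ContactKubo and, with
PinnedSteadyStateExists, clause (i) of FouriersLawFor. Print: uniqueness of the INVARIANT MEASURE
(CuneoEckmannHairerReyBellet2018 Thm 2.13(1); Carmona2007 Thm 1.1(iii)); the item additionally needs
'weak stationary Fokker–Planck solution ⇒ P_t-invariant' for this hypoelliptic L with cubic drift.
[difficulty: L] [CuneoEckmannHairerReyBellet2018, Carmona2007]
#9 PinnedSteadyStateExists (support) — [shared verbatim with stmt-AtomisticToContinuum-9900;
provable now; added by the 2026-08-15 cone repair] clause-(i) existence of a weak steady state of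
pinnedChain for every N and T_L, T_R > 0 — in tree as the PROVED pinnedChain_exists_isSteadyState
(LangevinChainNESSHolds.lean); a hypothesis of `closes` so that the route file need not import
LangevinChainNESSHolds. [difficulty: provable-now] [CuneoEckmannHairerReyBellet2018]
#9 EchoBounds (support) — [sanity anchor, fixed N] 0 ≤ ∫₀^∞ c_N ≤ γT²/2, i.e. 0 ≤ G_N ≤ γ/2 (given
integrability): upper bound from ∫₀^∞ c_N = ¼[⟨w_L+w_R, R(w_L+w_R)⟩ − ⟨w_L−w_R, R(w_L−w_R)⟩] = γT²/2
− 𝓔/4 with R = (−L)⁻¹ = ∫₀^∞ P_t and 𝓔 ≥ 0 (accretivity); lower bound = second law at first order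
(entropy production J̃(1/T_R − 1/T_L) ≥ 0). Equality G = γ/2 iff 𝓔 = 0 (the N = 1 value G_1 = γ/2).
A numerical violation would signal a convention slip in c_N, not physics. Not used by `closes`.
[difficulty: M] [BonettoLebowitzReyBellet2000, MaesNetocnyVerschuere2003, ReyBellet2003]
#9 EchoLimitOfWindows (support) — [glue, provable now, used by `closes`] the three windows plus
integrability (from ContactKubo under NessUnique) give the target: for N large (N/v ≤ N^a) split
∫₀^∞ = ∫₀^(N/v) + ∫_(N/v)^(N^a) + ∫_(N^a)^∞ with v from DarkTime and a from PolynomialGapTail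
(Icc/Ioc endpoints are null sets), bound the outer pieces by the ∫|c_N| of W1/W3, apply
EquilibriumFluctuationWindow at (v, a), squeeze; κ := the κ of W2. Pure real analysis
(setIntegral_union, norm_integral_le_integral_norm, Tendsto.add), ~100 lines. [difficulty:
provable-now] [BonettoLebowitzReyBellet2000]

TWO-LAYER PLAN. Foreseen glued splits (k ≤ 3, depth 1), filed only after a crux closes or a prover
proposes: EquilibriumFluctuationWindow ⇐ (ScalingLimit: N³ c_N(N² s) →
T² K_T(s) locally uniformly on (0,∞), ∫ K_T = κ) → (UniformIntegrability: (N−1)|c_N| has o(1) mass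
on [N/v, εN²] ∪ [AN², N^a] as ε → 0, A → ∞) → W2;
PolynomialGapTail ⇐ (ContactGapBound: ‖P_t w_R‖_(L²(μ_T)) ≤ C N^m e^(−ctN^(−b))) → W3; DarkTime ⇐
(CovarianceLiebRobinson: |Cov(w_L, P_t w_R)| ≤
C(1+t)^m e^(−c(N−v₀t))) → W1; ContactKubo ⇐ (FiniteResponse = stmt-0717, shared) → (MixedKuboForm) →
(SumRule) → K.

KILL CRITERIA. ¬EquilibriumFluctuationWindow with a proof that hyperbolic or polynomial windows
carry Θ(1/N) mass, or that the window limit is 0 or ∞ for admissible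
parameters, closes the route (close --reason refuted:EquilibriumFluctuationWindow) — if the limit
merely depends on (v, a), pivot to a restated W2 with
the windows that work (new item, glue re-certified). ¬PolynomialGapTail for every a (contact
relaxation slower than any power of N) forces a pivot to a
stretched-exponential tail statement, or closes the line if (N−1)∫_(N^a)^∞|c_N| ↛ 0 for all a.
¬ContactKubo (linear response fails or the cross form is
wrong) kills the whole contact programme (and FourierGreenKubo's 0717 with it). A refutation of
NessUnique refutes clause (i) of the conjunct itself.
FouriersLaw proved via FourierGreenKubo / OddSectorIrreversibility moots the route; EchoLimit proved
elsewhere reduces it to ContactKubo + NessUnique.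

NOT DECOMPOSED YET. The scaling-limit / uniform-integrability split of W2 and the identification of
κ(T) (Robin kernel, Kapitza length); the pointwise gap bound behind W3
and its exponent b; the covariance Lieb–Robinson inequality behind W1 and its velocity; the
Hairer–Majda verification and the Π-reversibility / sum-rule
lemmas inside ContactKubo (layer-2 children or `--supports` lemmas, later); positivity (P′) c_N ≥ 0
is NOT filed (true for every harmonic chain, hence not
diagnostic — refuter audit of the card); no `contactEcho` abbreviation is requested (c_N stays
inlined so every item elaborates today).

CHEAPEST FALSIFIER. Equilibrium MD of the open chain (ω₂ = lam = β = γ = 1, T ∈ {1, 0.1}, N ∈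
{8,…,256}): estimate c_N(t) = ⟨w_L(0) w_R(t)⟩ (no temperature difference,
signal O(1/N) directly). The line dies if (N−1)∫c_N fails to plateau (numerical Fourier law says it
plateaus) and is CALIBRATED otherwise: onset ≈ N/v
(W1), bulk of the mass at t ∼ N² (W2), terminal exponential rate vs N (W3: fit b; b ≥ 3 at the
harmonic corner). Identity check already run by the
gen-1 planner (harmonic N = 2,3,4, exact Gaussian formulas): G_N = T⁻²∫c_N ✓, auto + cross = γT² ✓,
0 ≤ G_N ≤ γ/2 ✓. Lookup falsifier for novelty: a
printed windowed proof of D_N → κ for ANY boundary-driven Hamiltonian chain (none found, see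
Novelty).

NUMBERS. Harmonic chain (lam = β = 0, outside the conjunct): λ_S ≍ N⁻³ exactly (BeckerMenegaki2022
Thm 1), ballistic, W2 fails, W1/W3 hold — so a > b ≥ 3 there
and presumably nearby; λ_S ≤ γ/N for every harmonic chain (BeckerMenegaki2022_gapClosing, PROVED);
equilibrium transport bound for every chain: any
L²(μ_T) rate with prefactor C obeys λ ≤ 4√2 γ ln(2C)/√N (equilibrium_rate_bound, PROVED); G_1 = γ/2,
0 ≤ G_N ≤ γ/2; harmonic G_N at ω₂ = γ = T = 1:
0.1667, 0.1364, 0.1279 (N = 2,3,4) → c_∞ > 0 (ballistic). Items at open: 9 (4 cruxes, 1 target, 3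
support, 1 assembly); after the 2026-08-15 cone repair: 10 (4 cruxes, 1 target, 4 support incl. the
shared NessUnique 0741 and PinnedSteadyStateExists 9900, 1 assembly).

DEFINITION REQUESTS. None blocking: c_N is inlined over OscillatorChain.transitionKernel /
gibbsMeasure (LangevinChainKernel / LangevinChainGibbs, both in tree — the route file's only
Literature imports after the cone repair; needs-fact: none). Nice-to-have,
filed only if provers ask: `contactPower`, `contactEcho` abbreviations under
Summits/AtomisticToContinuum/FouriersLaw/Theorems to shorten signatures.

Novelty: Searches (2026-08-15, this planner, on top of the card's and the refuter audit's of the same day):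
`lit search --source crossref "Lieb-Robinson classical
anharmonic lattice heat conduction"` (8: RazSims2009, NachtergaeleEtAl2008, doi:10.4064/cm118-2-17
Amour–Lévy-Bruhl–Nourrigat — none tied to conductance
limits); `lit search --source s2 "Green-Kubo formula for heat conduction in open systems boundary
current"` (5: KunduDharNarayan2009, arXiv:1009.0366,
arXiv:1808.10870); `lit read arXiv:1009.0366 --grep` (Kundu 2010: exact boundary-current
autocorrelation for the disordered HARMONIC open chain, "the GK
integral depends only on A_N(t)", the end-to-end term — the harmonic shadow of the cross form, no
windows, no anharmonicity); `lit search --hybrid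
"Green-Kubo open system reservoir current cross-correlation conductance Lieb-Robinson time window"`
(12 textbook hits: Livi–Politi 2017/2025, Evans–Morriss,
Dorfman — generic GK); `lit frontier AtomisticToContinuum --since 2023` (30 rows; heat-conduction
descendants arXiv:2310.13338 (Invent. Math. 2026),
arXiv:2604.14056 — neither windowed/open-GK); `lit galaxy search "Green-Kubo formula for heat
conduction" --star all` (3: Lepri (ed.) LNP 921, Stoltz HDR,
arXiv:2104.05222) and `"Lieb-Robinson bounds for harmonic and anharmonic" --star all` (2, quantum);
OpenAlex 429, zbMATH 0.
Nearest prior art found: JaksicOgataPillet2006 (eq. (1.1), §2.4: kinetic coefficient = ½∫ω_β(Φ_A τ^t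
Φ_C)dt, the cross-correlation of two reservoir
fluxes, q  [refs: 10.4064/cm118-2-17, 1009.0366, 1808.10870, 2310.13338, 2604.14056, 2104.05222, doi:10.4064/cm118-2-17, RazSims2009, NachtergaeleEtAl2008, KunduDharNarayan2009, JaksicOgataPillet2006, MaesNetocnyVerschuere2003, ButtaEtAl2007, Menegaki2020, BeckerMenegaki2022, KomorowskiOlla2021]

Barriers (technique_class: contact-green-kubo time-windows polynomial-gap-tail): - technique_class: contact-green-kubo time-windows polynomial-gap-tail
- Literature.Barriers.AtomisticToContinuum.BeckerMenegaki2022_gapClosing: EMBRACED — W3 asks only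
SOME polynomial rate N^(−b) for contact observables (a > b free; harmonic corner b = 3), never an
N-uniform gap; consistent with λ_S ≤ γ/N and with the PROVED equilibrium transport bound λ ≤ 4√2 γ
ln(2C)/√N (equilibrium_rate_bound): rates are used only at times t ≥ N^a ≫ N².
- Literature.Barriers.AtomisticToContinuum.MacroErgodicityBarrier: it does not fully evade; the bet
is that W2 sits at the barrier's weakest corner — EQUILIBRIUM (no NESS), two boundary observables,
second moments, a time WINDOW whose ends are cut by W1/W3 — so no relative-entropy/one-block
statement for all local functions and no sector condition is needed.
- Literature.Barriers.AtomisticToContinuum.HasBoundedResponse: evaded by construction — a limit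
theorem across N; fixed-N theory enters only through W3's rate, whose N-dependence is exactly what
is tracked (polynomially); HasBoundedResponse follows from W1–W3 + ContactKubo but is not an input.
- Literature.Barriers.AtomisticToContinuum.HarmonicChainBallisticFlux: consistent — at lam = β = 0
W1 and W3 hold while W2 fails ((N−1)∫c_N → ∞: gen-1 numerics 0.167, 0.136, 0.128, … ↛ 0·N⁻¹), so the
skeleton produces no false Fourier law; nothing is perturbative around the harmonic point.
- Literature.Barriers.AtomisticToContinuum.Mazur1969_inequality: an extensive conserved charge
overlapping t

History (route lifecycle, newest last):
- 2026-08-15T19:24:04Z · rev 2: restated Assembly (stmt-AtomisticToContinuum-11825) — route-repair (cone) 2026-08-15, follow-up: restate Assembly to the literal type of the re-certified `closes` (PinnedSteadyStateExists inserted after the NESSHol (planner-rrepair-AtomisticToContinuum-ContactEc-2018f518-0)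
- 2026-08-22T06:39:34Z · DORMANT — reconciler: no traction for 5.1 d (last activity item-evidence-added at 2026-08-17T02:45:08Z); parked, not closed — `ledger route dormant route-AtomisticToConti (operator:999:3580245)

sub-problem: FouriersLaw · status: dormant · opened planner-plancard-AtomisticToContinuum-Fourier-47b6c42a-g2-0 2026-08-15T18:44:08Z · rev 3 · ledger route-AtomisticToContinuum-ContactEchoEpochs
GENERATED by the gate from the ledger (D-0016/17). Provers cite these decls: `theorem foo : Summit.AtomisticToContinuum.FouriersLaw.Theses.ContactEchoEpochs.<Decl> := …` in Summits/AtomisticToContinuum/FouriersLaw/Theorems/<Name>.lean.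
-/

namespace Summit.AtomisticToContinuum.FouriersLaw.Theses.ContactEchoEpochs

open scoped BigOperators Topology Manifold Classical MeasureTheory ProbabilityTheory Matrix InnerProductSpace ComplexConjugate ContinuousMap
open Filter Set Function TopologicalSpace MeasureTheory

attribute [summit_statement] _root_.FouriersLaw

/-- item stmt-AtomisticToContinuum-11818 · target · rank 0 · open · by planner
why it might fail: inherits W2 (deterministic-chain equilibrium fluctuation limit, MacroErgodicity class) and W3 (no N-polynomial relaxation bound beyond near-harmonic chains); κ might exist only along subsequences if hyperbolic/polynomial windows carry Θ(1/N) mass.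
sources: BonettoLebowitzReyBellet2000, KunduDharNarayan2009, JaksicOgataPillet2006, Bernardin2014, BeckerMenegaki2022
[target] CONTACT-ECHO FORM OF FOURIER'S LAW: for all ω₂, lam, β, γ > 0 and T > 0 there is κ > 0 with
(N−1) T⁻² ∫₀^∞ c_N(t) dt → κ as N → ∞ (N = n+2; c_N as in the Thesis, inlined over
transitionKernel/gibbsMeasure; the set integral is Lean-junk 0 unless c_N ∈ L¹(0,∞), which
ContactKubo supplies). With ContactKubo this is exactly 'D_N → κ(T) ∈ (0,∞)' for every steady-state
family; it is the common consequence of W1–W3 (support EchoLimitOfWindows). -/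
@[route_item "route-AtomisticToContinuum-ContactEchoEpochs"]
def EchoLimit : Prop :=
  ∀ ω₂ lam β γ : ℝ, 0 < ω₂ → 0 < lam → 0 < β → 0 < γ → ∀ T : ℝ, 0 < T → ∃ κ : ℝ, 0 < κ ∧ Filter.Tendsto (fun n : ℕ => ((n : ℝ) + 1) / T ^ 2 * ∫ t in Set.Ioi (0 : ℝ), (∫ z, γ * (T - (z.2 0) ^ 2) * (∫ y, γ * (T - (y.2 (Fin.last (n + 1))) ^ 2) ∂((Literature.MathematicalPhysics.KineticTheory.HeatConduction.pinnedChain ω₂ lam β γ).transitionKernel (n + 2) T T (Real.toNNReal t) z)) ∂((Literature.MathematicalPhysics.KineticTheory.HeatConduction.pinnedChain ω₂ lam β γ).gibbsMeasure (n + 2) T))) Filter.atTop (nhds κ)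

/-- item stmt-AtomisticToContinuum-11819 · crux · rank 2 · open · by planner
why it might fail: Boltzmann–Gibbs / fluctuation–dissipation for a DETERMINISTIC anharmonic bulk is open even at equilibrium (MacroErgodicity class); the contact (Kapitza) boundary condition is identified only for harmonic/noisy chains; '∀ a' also asserts no Θ(1/N) mass at polynomial times ≫ N².
sources: Bernardin2014, KomorowskiOlla2021, KomorowskiOllaSimon2021, KomorowskiOlla2020, BonettoLebowitzReyBellet2000, arXiv:2310.13338
[crux] (W2, card crux 1) for all parameters > 0 and T > 0 there is κ > 0 such that for EVERY v > 0
and EVERY a > 2: (N−1) T⁻² ∫_(N/v)^(N^a) c_N(t) dt → κ. Informally: on diffusive scales N³ c_N(N² s)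
→ T² K_T(s), K_T = contact-to-contact flux kernel of ∂_s e = κ ∂_x² e on [0,1] with thermalising
(Robin/Kapitza) boundary conditions, ∫₀^∞ K_T = κ, with enough uniform integrability that hyperbolic
times t ∈ [N/v, εN²] and polynomial times t ∈ [AN², N^a] carry o(1/N); an EQUILIBRIUM
energy-fluctuation limit for two boundary observables of the OPEN chain (Ornstein–Uhlenbeck
fluctuation field + Boltzmann–Gibbs principle for w_L, w_R) — the corner where κ(T) is defined.
[difficulty: open-problem] -/
@[route_item "route-AtomisticToContinuum-ContactEchoEpochs", crux]
def EquilibriumFluctuationWindow : Prop :=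
  ∀ ω₂ lam β γ : ℝ, 0 < ω₂ → 0 < lam → 0 < β → 0 < γ → ∀ T : ℝ, 0 < T → ∃ κ : ℝ, 0 < κ ∧ ∀ v : ℝ, 0 < v → ∀ a : ℝ, 2 < a → Filter.Tendsto (fun n : ℕ => ((n : ℝ) + 1) / T ^ 2 * ∫ t in Set.Icc (((n : ℝ) + 2) / v) (((n : ℝ) + 2) ^ a), (∫ z, γ * (T - (z.2 0) ^ 2) * (∫ y, γ * (T - (y.2 (Fin.last (n + 1))) ^ 2) ∂((Literature.MathematicalPhysics.KineticTheory.HeatConduction.pinnedChain ω₂ lam β γ).transitionKernel (n + 2) T T (Real.toNNReal t) z)) ∂((Literature.MathematicalPhysics.KineticTheory.HeatConduction.pinnedChain ω₂ lam β γ).gibbsMeasure (n + 2) T))) Filter.atTop (nhds κ)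

/-- item stmt-AtomisticToContinuum-11820 · crux · rank 3 · open · by planner
why it might fail: N-dependent lower bounds on relaxation exist only near-harmonic (Menegaki2020: N⁻³-type under N-small anharmonicity); metastable high-energy (breather-like) states could make contact relaxation slower than any power of N (cf. essential spectrum at 0 when pinning dominates, HairerMattingly2009).
sources: BeckerMenegaki2022, Menegaki2020, CuneoEckmannHairerReyBellet2018, HairerMattingly2009, Znidaric2015
[crux] (W3, card crux 2, integrated form) for all parameters > 0 and T > 0 there is a > 2 such that
t ↦ c_N(t) is integrable on (N^a, ∞) for every N and (N−1) T⁻² ∫_(N^a)^∞ |c_N(t)| dt → 0.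
Sufficient: an L²(μ_T) relaxation bound for the contact observable with POLYNOMIAL N-tracking, ‖P_t
w_R‖₂ ≤ C N^m e^(−c t N^(−b)) (then any a > b works; the harmonic corner has exactly b = 3, so
expect a > b ≥ 3); stretched-exponential or t^(−k) N^m decay also suffices. Consistent with λ_S ≤
γ/N (BeckerMenegaki2022_gapClosing) and with the equilibrium transport bound λ ≤ 4√2 γ ln(2C)/√N
(equilibrium_rate_bound, PROVED): rates are used only at times t ≥ N^a ≫ N². [difficulty: XL] -/
@[route_item "route-AtomisticToContinuum-ContactEchoEpochs", crux]
def PolynomialGapTail : Prop :=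
  ∀ ω₂ lam β γ : ℝ, 0 < ω₂ → 0 < lam → 0 < β → 0 < γ → ∀ T : ℝ, 0 < T → ∃ a : ℝ, 2 < a ∧ (∀ n : ℕ, MeasureTheory.IntegrableOn (fun t : ℝ => (∫ z, γ * (T - (z.2 0) ^ 2) * (∫ y, γ * (T - (y.2 (Fin.last (n + 1))) ^ 2) ∂((Literature.MathematicalPhysics.KineticTheory.HeatConduction.pinnedChain ω₂ lam β γ).transitionKernel (n + 2) T T (Real.toNNReal t) z)) ∂((Literature.MathematicalPhysics.KineticTheory.HeatConduction.pinnedChain ω₂ lam β γ).gibbsMeasure (n + 2) T))) (Set.Ioi (((n : ℝ) + 2) ^ a))) ∧ Filter.Tendsto (fun n : ℕ => ((n : ℝ) + 1) / T ^ 2 * ∫ t in Set.Ioi (((n : ℝ) + 2) ^ a), |(∫ z, γ * (T - (z.2 0) ^ 2) * (∫ y, γ * (T - (y.2 (Fin.last (n + 1))) ^ 2) ∂((Literature.MathematicalPhysics.KineticTheory.HeatConduction.pinnedChain ω₂ lam β γ).transitionKernel (n + 2) T T (Real.toNNReal t) z)) ∂((Literature.MathematicalPhysics.KineticTheory.HeatConduction.pinnedChain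 ω₂ lam β γ).gibbsMeasure (n + 2) T))|) Filter.atTop (nhds 0)

/-- item stmt-AtomisticToContinuum-11821 · crux · rank 4 · open · by planner
why it might fail: sup-norm Lieb–Robinson is false for unbounded (quartic) forces; the printed Gibbs-averaged bounds (ButtaEtAl2007, RazSims2009) have cones r ∼ t log^α t and moment prefactors, so a fixed v may need 'no mass just after arrival' too; Langevin contacts must not spoil quasi-locality.
sources: NachtergaeleEtAl2008, RazSims2009, ButtaEtAl2007, MarchioroPellegrinottiPulvirenti1978, doi:10.4064/cm118-2-17
[crux] (W1, card crux 3, integrated form) for all parameters > 0 and T > 0 there is v > 0 with (N−1)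
T⁻² ∫₀^(N/v) |c_N(t)| dt → 0. Sufficient: a covariance-form classical Lieb–Robinson bound for the
thermal pinned chain, |Cov_(μ_T)(w_L, P_t w_R)| ≤ C (1+t)^m e^(−c(N − v₀t)) for t ≤ N/v₀ (take v =
2v₀); note c_N(0) = 0 exactly (p_0 ⊥ p_(N−1) under μ_T) and equal-time spatial correlations of μ_T
decay exponentially (1-D transfer operator). [difficulty: L] -/
@[route_item "route-AtomisticToContinuum-ContactEchoEpochs", crux]
def DarkTime : Prop :=
  ∀ ω₂ lam β γ : ℝ, 0 < ω₂ → 0 < lam → 0 < β → 0 < γ → ∀ T : ℝ, 0 < T → ∃ v : ℝ, 0 < v ∧ Filter.Tendsto (fun n : ℕ => ((n : ℝ) + 1) / T ^ 2 * ∫ t in Set.Icc 0 (((n : ℝ) + 2) / v), |(∫ z, γ * (T - (z.2 0) ^ 2) * (∫ y, γ * (T - (y.2 (Fin.last (n + 1))) ^ 2) ∂((Literature.MathematicalPhysics.KineticTheory.HeatConduction.pinnedChain ω₂ lam β γ).transitionKernel (n + 2) T T (Real.toNNReal t) z)) ∂((Literature.MathematicalPhysics.KineticTheory.HeatConduction.pinnedChain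 ω₂ lam β γ).gibbsMeasure (n + 2) T))|) Filter.atTop (nhds 0)

/-- item stmt-AtomisticToContinuum-11822 · crux · rank 5 · open · by planner
why it might fail: BLR p.16: the Kubo formula (32) is unproved for Langevin reservoirs; Hairer–Majda needs the perturbation (γ/2)(∂²_(p_0) − ∂²_(p_(N−1))) tamed by ONE weighted space with spectral gap for all small δ, and c_N ∈ L¹ needs mixing for quadratic observables, printed only in e^(θH)-weighted sup norms.
sources: HairerMajda2009, ReyBellet2003, KunduDharNarayan2009, JaksicOgataPillet2006, MaesNetocnyVerschuere2003, CuneoEckmannHairerReyBellet2018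
[crux] (K, card support (a)(b), fixed N, theorem-grade but unprinted) CONTACT FORM OF THE
FINITE-VOLUME KUBO FORMULA: for all parameters > 0, IF weak steady states (IsSteadyState) are unique
for all N, T_L, T_R > 0 (= NessUnique), then for every T > 0 and N = n+2: t ↦ c_N(t) is integrable
on (0,∞), and for every family μ of weak steady states lim_(δ→0,δ≠0) totalCurrent(μ N (T+δ/2)
(T−δ/2))/δ = (N−1) T⁻² ∫₀^∞ c_N(t) dt. Content: (a) Hairer–Majda linear response for the
hypoelliptic Langevin chain (CEHR Lyapunov/spectral-gap structure), response of J̃ = μ_δ(w_L^(T_L))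
to ∂_δ L = (γ/2)(∂²_(p_0) − ∂²_(p_(N−1))): G_N = γ/2 + (2T²)⁻¹ ∫₀^∞ ⟨w_R − w_L, P_t w_L⟩ dt; (b)
Π-reversibility (P_t* = Π P_t Π in L²(μ_T), w's even) gives ⟨w_R, P_t w_L⟩ = ⟨w_L, P_t w_R⟩; (c) the
single-bath sum rule ∫₀^∞ ⟨w_L, P_t(w_L + w_R)⟩ dt = γ Cov(p_0², H) = γT² (L H = w_L + w_R:
generator_hamiltonian_two_baths, PROVED) kills the auto term: G_N = T⁻² ∫₀^∞ c_N; all bond currents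
have mean J̃, totalCurrent = (N−1) J̃; N ≤ 1 has no bonds (handled in `closes`). Checked numerically
by the gen-1 planner (harmonic N = 2,3,4, Lyapunov equation vs matrix-exponential quadrature: J̃/δ =
T⁻²∫c_N to 6 digits, 0.1667, 0.1364 -/
@[route_item "route-AtomisticToContinuum-ContactEchoEpochs", crux]
def ContactKubo : Prop :=
  ∀ ω₂ lam β γ : ℝ, 0 < ω₂ → 0 < lam → 0 < β → 0 < γ → (∀ (N : ℕ) (T_L T_R : ℝ), 0 < T_L → 0 < T_R → ∀ μ ν : MeasureTheory.Measure (Literature.MathematicalPhysics.KineticTheory.HeatConduction.PhaseSpace N), (Literature.MathematicalPhysics.KineticTheory.HeatConduction.pinnedChain ω₂ lam β γ).IsSteadyState N T_L T_R μ → (Literature.MathematicalPhysics.KineticTheory.HeatConduction.pinnedChain ω₂ lam β γ).IsSteadyState N T_L T_R ν → μ = ν) → ∀ T : ℝ, 0 < T → ∀ n : ℕ, MeasureTheory.IntegrableOn (fun t : ℝ => (∫ z, γ * (T - (z.2 0) ^ 2) * (∫ y, γ * (T - (y.2 (Fin.last (n + 1))) ^ 2) ∂((Literature.MathematicalPhysics.KineticTheory.HeatConduction.pinnedChain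 ω₂ lam β γ).transitionKernel (n + 2) T T (Real.toNNReal t) z)) ∂((Literature.MathematicalPhysics.KineticTheory.HeatConduction.pinnedChain ω₂ lam β γ).gibbsMeasure (n + 2) T))) (Set.Ioi 0) ∧ ∀ μ : (N : ℕ) → ℝ → ℝ → MeasureTheory.Measure (Literature.MathematicalPhysics.KineticTheory.HeatConduction.PhaseSpace N), (∀ (N : ℕ) (T_L T_R : ℝ), 0 < T_L → 0 < T_R → (Literature.MathematicalPhysics.KineticTheory.HeatConduction.pinnedChain ω₂ lam β γ).IsSteadyState N T_L T_R (μ N T_L T_R)) → Filter.Tendsto (fun δ : ℝ => (Literature.MathematicalPhysics.KineticTheory.HeatConduction.pinnedChain ω₂ lam β γ).totalCurrent (μ (n + 2) (T + δ / 2) (T - δ / 2)) / δ) (nhdsWithin 0 {(0 : ℝ)}ᶜ) (nhds (((n : ℝ) + 1) / T ^ 2 * ∫ t in Set.Ioi (0 : ℝ), (∫ z, γ * (T - (z.2 0) ^ 2) * (∫ y, γ * (T - (y.2 (Fin.last (n + 1))) ^ 2) ∂((Literature.MathematicalPhysics.KineticTheory.HeatConduction.pinnedChain ω₂ lam β γ).transitionKernel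 (n + 2) T T (Real.toNNReal t) z)) ∂((Literature.MathematicalPhysics.KineticTheory.HeatConduction.pinnedChain ω₂ lam β γ).gibbsMeasure (n + 2) T))))

/-- item stmt-AtomisticToContinuum-0741 · support · rank 9 · closed · proved by Summit.AtomisticToContinuum.FouriersLaw.Theorems.nessUnique_proof (prover) · by planner
[crux] UNIQUENESS OF THE WEAK STEADY STATE (the half of stmt-0706 not covered by the landed fact
Literature.MathematicalPhysics.KineticTheory.HeatConduction.CuneoEckmannHairerReyBellet2018_pinnedChain,
p3544): for pinnedChain ω₂ lam β γ (all > 0), every N and T_L, T_R > 0, any two measures in the weak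
Fokker–Planck class IsSteadyState (probability, ∫ L f dμ = 0 for f ∈ C_c^∞, bond currents
integrable) coincide. Print: uniqueness of the INVARIANT MEASURE of the Langevin semigroup
(CuneoEckmannHairerReyBellet2018 Thm 2.13(1): C1, C2, CA; Carmona2007 Thm 1.1(iii)); the item
additionally needs 'weak stationary probability solution of L*μ = 0 ⇒ P_t-invariant' for this
hypoelliptic L with cubic drift (Echeverría 1982 well-posed martingale problem on C_c^∞ +
non-explosion via e^{θH}; Bogachev–Krylov–Röckner–Shaposhnikov 2015 Ch. 5 is non-degenerate only) —
the FP-identification lemma is the formal crux. N = 0: PhaseSpace 0 is a point (unique probability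
measure); N = 1: both baths on site 0, OU at temperature (T_L+T_R)/2. This is exactly the hypothesis
of FiniteResponse and ThermodynamicLimit and, with the fact, gives clause (i) of FouriersLawFor. -/
@[route_item "route-AtomisticToContinuum-ContactEchoEpochs", crux]
def NessUnique : Prop :=
  ∀ ω₂ lam β γ : ℝ, 0 < ω₂ → 0 < lam → 0 < β → 0 < γ → ∀ (N : ℕ) (T_L T_R : ℝ), 0 < T_L → 0 < T_R → ∀ μ ν : MeasureTheory.Measure (Literature.MathematicalPhysics.KineticTheory.HeatConduction.PhaseSpace N), (Literature.MathematicalPhysics.KineticTheory.HeatConduction.pinnedChain ω₂ lam β γ).IsSteadyState N T_L T_R μ → (Literature.MathematicalPhysics.KineticTheory.HeatConduction.pinnedChain ω₂ lam β γ).IsSteadyState N T_L T_R ν → μ = ν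

/-- `NessUnique` holds: proved by `Summit.AtomisticToContinuum.FouriersLaw.Theorems.nessUnique_proof`. -/
theorem NessUnique_holds : NessUnique := _root_.Summit.AtomisticToContinuum.FouriersLaw.Theorems.nessUnique_proof

/-- item stmt-AtomisticToContinuum-11823 · support · rank 9 · closed · proved by Summit.AtomisticToContinuum.FouriersLaw.Theorems.echoBounds_proof @ b2d3e0ae4bc2 (prover) · by planner
sources: BonettoLebowitzReyBellet2000, MaesNetocnyVerschuere2003, ReyBellet2003
[support] [sanity anchor, fixed N] 0 ≤ ∫₀^∞ c_N ≤ γT²/2, i.e. 0 ≤ G_N ≤ γ/2 (given integrability):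
upper bound from ∫₀^∞ c_N = ¼[⟨w_L+w_R, R(w_L+w_R)⟩ − ⟨w_L−w_R, R(w_L−w_R)⟩] = γT²/2 − 𝓔/4 with R =
(−L)⁻¹ = ∫₀^∞ P_t and 𝓔 ≥ 0 (accretivity); lower bound = second law at first order (entropy
production J̃(1/T_R − 1/T_L) ≥ 0). Equality G = γ/2 iff 𝓔 = 0 (the N = 1 value G_1 = γ/2). A
numerical violation would signal a convention slip in c_N, not physics. Not used by `closes`.
[difficulty: M] -/
@[route_item "route-AtomisticToContinuum-ContactEchoEpochs"]
def EchoBounds : Prop :=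
  ∀ ω₂ lam β γ : ℝ, 0 < ω₂ → 0 < lam → 0 < β → 0 < γ → ∀ T : ℝ, 0 < T → ∀ n : ℕ, MeasureTheory.IntegrableOn (fun t : ℝ => (∫ z, γ * (T - (z.2 0) ^ 2) * (∫ y, γ * (T - (y.2 (Fin.last (n + 1))) ^ 2) ∂((Literature.MathematicalPhysics.KineticTheory.HeatConduction.pinnedChain ω₂ lam β γ).transitionKernel (n + 2) T T (Real.toNNReal t) z)) ∂((Literature.MathematicalPhysics.KineticTheory.HeatConduction.pinnedChain ω₂ lam β γ).gibbsMeasure (n + 2) T))) (Set.Ioi 0) → 0 ≤ (∫ t in Set.Ioi (0 : ℝ), (∫ z, γ * (T - (z.2 0) ^ 2) * (∫ y, γ * (T - (y.2 (Fin.last (n + 1))) ^ 2) ∂((Literature.MathematicalPhysics.KineticTheory.HeatConduction.pinnedChain ω₂ lam β γ).transitionKernel (n + 2) T T (Real.toNNReal t) z)) ∂((Literature.MathematicalPhysics.KineticTheory.HeatConduction.pinnedChain ω₂ lam β γ).gibbsMeasure (n + 2) T))) ∧ (∫ t in Set.Ioi (0 : ℝ), (∫ z, γ * (T - (z.2 0)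 ^ 2) * (∫ y, γ * (T - (y.2 (Fin.last (n + 1))) ^ 2) ∂((Literature.MathematicalPhysics.KineticTheory.HeatConduction.pinnedChain ω₂ lam β γ).transitionKernel (n + 2) T T (Real.toNNReal t) z)) ∂((Literature.MathematicalPhysics.KineticTheory.HeatConduction.pinnedChain ω₂ lam β γ).gibbsMeasure (n + 2) T))) ≤ γ * T ^ 2 / 2

/-- item stmt-AtomisticToContinuum-11824 · support · rank 9 · closed · proved by Summit.AtomisticToContinuum.FouriersLaw.Theorems.echoLimitOfWindows_proof (prover) · by planner
sources: BonettoLebowitzReyBellet2000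
[support] [glue, provable now, used by `closes`] the three windows plus integrability (from
ContactKubo under NessUnique) give the target: for N large (N/v ≤ N^a) split ∫₀^∞ = ∫₀^(N/v) +
∫_(N/v)^(N^a) + ∫_(N^a)^∞ with v from DarkTime and a from PolynomialGapTail (Icc/Ioc endpoints are
null sets), bound the outer pieces by the ∫|c_N| of W1/W3, apply EquilibriumFluctuationWindow at (v,
a), squeeze; κ := the κ of W2. Pure real analysis (setIntegral_union,
norm_integral_le_integral_norm, Tendsto.add), ~100 lines. [difficulty: provable-now] -/
@[route_item "route-AtomisticToContinuum-ContactEchoEpochs", crux]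
def EchoLimitOfWindows : Prop :=
  ContactKubo → NessUnique → DarkTime → EquilibriumFluctuationWindow → PolynomialGapTail → EchoLimit

/-- item stmt-AtomisticToContinuum-9900 · support · rank 9 · closed · proved by Summit.AtomisticToContinuum.FouriersLaw.Theorems.pinnedSteadyStateExists_proof @ 93199528ccef (prover) · by planner
sources: CuneoEckmannHairerReyBellet2018, Carmona2007
[support] CLAUSE (i) EXISTENCE FOR THE CONJUNCT'S CHAIN (route-repair 2026-08-15, cone bookkeeping;
provable now; kind support, rank 9): for pinnedChain ω₂ lam β γ with ω₂, lam, β, γ > 0, every N and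
all T_L, T_R > 0 there is a weak (Fokker–Planck) steady state (OscillatorChain.IsSteadyState).
PROVED in tree:
Literature.MathematicalPhysics.KineticTheory.HeatConduction.pinnedChain_exists_isSteadyState
(LangevinChainNESSHolds.lean; the discharged fact CuneoEckmannHairerReyBellet2018_pinnedChain for N
≥ 1 + OscillatorChain.isSteadyState_zero for N = 0) — a Theorems file importing the route file +
LangevinChainNESSHolds closes it in one line (evidence file attached:
PinnedSteadyStateExistsProof.lean, rc 0, axioms propext/Classical.choice/Quot.sound). WHY AN ITEM:
it lets the deciding theorem 'closes' take clause (i) existence as a hypothesis, so that the Theses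
file can drop the import Literature.MathematicalPhysics.KineticTheory.LangevinChainNESSHolds
(≈55-module Langevin-SDE cone with the two undischarged Kolmogorov–Chentsov Hölder facts) — the
pending route-repair edit (imports := [InfiniteChainDynamics], closes re-proved, Assembly restated;
package attached as evidence to the route -/
@[route_item "route-AtomisticToContinuum-ContactEchoEpochs", crux]
def PinnedSteadyStateExists : Prop :=
  ∀ ω₂ lam β γ : ℝ, 0 < ω₂ → 0 < lam → 0 < β → 0 < γ → ∀ (N : ℕ) (T_L T_R : ℝ), 0 < T_L → 0 < T_R → ∃ μ : MeasureTheory.Measure (Literature.MathematicalPhysics.KineticTheory.HeatConduction.PhaseSpace N), (Literature.MathematicalPhysics.KineticTheory.HeatConduction.pinnedChain ω₂ lam β γ).IsSteadyState N T_L T_R μ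

-- earlier Assembly (stmt-AtomisticToContinuum-11825, replaced 2026-08-15T19:24:04Z -> stmt-AtomisticToContinuum-13585): retired by None — NessUnique → ContactKubo → DarkTime → EquilibriumFluctuationWindow → PolynomialGapTail → EchoLimitOfWindows → _root_.FouriersLaw
/-- item stmt-AtomisticToContinuum-13585 · assembly · rank 1 · closed · proved by Summit.AtomisticToContinuum.FouriersLaw.Theorems.contactEchoEpochs_assembly_proof (prover) · by planner
sources: BonettoLebowitzReyBellet2000, CuneoEckmannHairerReyBellet2018
[assembly] NessUnique → PinnedSteadyStateExists → ContactKubo → DarkTime →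
EquilibriumFluctuationWindow → PolynomialGapTail → EchoLimitOfWindows → FouriersLaw (the sub-problem
Statement decl `_root_.FouriersLaw`); literally the type of the proved deciding theorem `closes`
(route-repair 2026-08-15: PinnedSteadyStateExists inserted when the NESSHolds import was dropped),
so `theorem assembly_holds : Assembly := closes` closes it. -/
@[route_item "route-AtomisticToContinuum-ContactEchoEpochs"]
def Assembly : Prop :=
  NessUnique → PinnedSteadyStateExists → ContactKubo → DarkTime → EquilibriumFluctuationWindow → PolynomialGapTail → EchoLimitOfWindows → _root_.FouriersLaw

/-! D-0027 §2.1 — DECIDING THEOREM (planner-authored via `route open/edit --closes-file`; by planner-rrepair-AtomisticToContinuum-ContactEc-2018f518-0 2026-08-15T19:20:06Z):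
its hypotheses are this route's items and its conclusion the sub-problem Statement (glue_lint), and it elaborates with this file. -/

@[closes "route-AtomisticToContinuum-ContactEchoEpochs"] theorem closes (hNU : NessUnique) (hEx : PinnedSteadyStateExists) (hCK : ContactKubo)
    (hW1 : DarkTime) (hW2 : EquilibriumFluctuationWindow) (hW3 : PolynomialGapTail)
    (hG : EchoLimitOfWindows) : _root_.FouriersLaw := by
  -- route-repair 2026-08-15 (cone): clause (i) existence is now the shared item PinnedSteadyStateExists
  -- (stmt-AtomisticToContinuum-9900, provable now from pinnedChain_exists_isSteadyState), so this file no
  -- longer imports LangevinChainNESSHolds; everything else is unchanged.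
  -- the three windows + the contact Kubo formula give the contact-echo limit (target EchoLimit)
  have hE : EchoLimit := hG hCK hNU hW1 hW2 hW3
  show Literature.MathematicalPhysics.KineticTheory.HeatConduction.FouriersLaw
  intro ω₂ lam β γ hω hl hβ hγ
  have hUq := hNU ω₂ lam β γ hω hl hβ hγ
  refine ⟨?_, ?_⟩
  · -- clause (i): existence is item PinnedSteadyStateExists, uniqueness is item NessUnique
    intro N T_L T_R hL hR
    obtain ⟨μ, hμ⟩ := hEx ω₂ lam β γ hω hl hβ hγ N T_L T_R hL hR
    exact ⟨μ, hμ, fun ν hν => hUq N T_L T_R hL hR ν μ hν hμ⟩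
  · -- clause (ii): κ T := the echo limit of EchoLimit at T (1 for T ≤ 0); D 0 = D 1 = 0 (no bonds),
    -- D (n+2) := (n+1)/T² ∫₀^∞ c_(n+2) = the response limit of ContactKubo for every steady-state family.
    classical
    have hEp := hE ω₂ lam β γ hω hl hβ hγ
    refine ⟨fun T => if hT : 0 < T then Classical.choose (hEp T hT) else 1, ?_, ?_⟩
    · intro T hT
      simp only [dif_pos hT]
      exact (Classical.choose_spec (hEp T hT)).1
    · intro μ hμ T hT
      have hK := hCK ω₂ lam β γ hω hl hβ hγ hUq T hT
      let D : ℕ → ℝ := fun N => match N with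
        | 0 => 0
        | 1 => 0
        | n + 2 => ((n : ℝ) + 1) / T ^ 2 * ∫ t in Set.Ioi (0 : ℝ), (∫ z, γ * (T - (z.2 0) ^ 2) * (∫ y, γ * (T - (y.2 (Fin.last (n + 1))) ^ 2) ∂((Literature.MathematicalPhysics.KineticTheory.HeatConduction.pinnedChain ω₂ lam β γ).transitionKernel (n + 2) T T (Real.toNNReal t) z)) ∂((Literature.MathematicalPhysics.KineticTheory.HeatConduction.pinnedChain ω₂ lam β γ).gibbsMeasure (n + 2) T))
      refine ⟨D, ?_, ?_⟩
      · intro N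
        match N with
        | 0 =>
          simp only [D, Literature.MathematicalPhysics.KineticTheory.HeatConduction.OscillatorChain.totalCurrent_zero, zero_div]
          exact tendsto_const_nhds
        | 1 =>
          have h1 : ∀ ν : MeasureTheory.Measure (Literature.MathematicalPhysics.KineticTheory.HeatConduction.PhaseSpace 1),
              (Literature.MathematicalPhysics.KineticTheory.HeatConduction.pinnedChain ω₂ lam β γ).totalCurrent ν = 0 := by
            intro ν
            simp [Literature.MathematicalPhysics.KineticTheory.HeatConduction.OscillatorChain.totalCurrent, Literature.MathematicalPhysics.KineticTheory.HeatConduction.OscillatorChain.bondCurrent]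
          simp only [D, h1, zero_div]
          exact tendsto_const_nhds
        | n + 2 =>
          exact (hK n).2 μ hμ
      · simp only [dif_pos hT]
        exact (Filter.tendsto_add_atTop_iff_nat 2).1 (Classical.choose_spec (hEp T hT)).2

end Summit.AtomisticToContinuum.FouriersLaw.Theses.ContactEchoEpochs
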